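import Summits.BirchSwinnertonDyer.Rank1Residual.X11a.PrintDischargeLocallySplit
import Literature.NumberTheory.EllipticCurves.TateParameterNotPthPowerOfJProofs
import HarnessLib

/-!
# Class X11a — the PRINT route's discharge interface: the image bit `Surj W p` from the RATIONAL Tate
# certificate `j(E)⁻¹ = p^k·(a/b)`, `p ∤ a`, `p ∤ b`, `p² ∤ a^{p−1} − b^{p−1}` (part 9b)

Cell `bsd-print-x11a` (D-0131 print tier), seat ty2 (the DISCHARGE INTERFACE). THEOREMS ONLY (no definition,
no named fact, no `sorry`); sequel of `X11a/PrintDischargeLocallySplit.lean` (part 9, at the 400-line cap with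
this section), whose §1 `GaloisImage.surj_of_mult_of_irr_of_forall_pow_ne_tateParameter` («`Mult ∧ Irr ∧
q_E ∉ (ℚ_p^×)^p ⟹ Surj`», `p` odd; Silverman ATAEC Prop. V.6.1's proof + Serre 1972 Prop. 15) takes the local
datum «the Tate parameter `q ∈ ℚ_v` is not a `p`-th power» as a hypothesis. Here that datum is DISCHARGED
from the RATIONAL unit-congruence certificate of ty2 g4's `Literature/…/TateParameterNotPthPowerOfJProofs.lean`
(`not_exists_pow_prime_eq_of_tateJ_eq_ratCast`, in `ℚ_[p]`: `j₀⁻¹ = p^k·u`, `v_p(u) = 0`,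
`|u^{p−1} − 1|_p > p^{−2}` ⟹ the Tate parameter of `j₀` is not a `p`-th power — Silverman V.3.1 (b) +
Serre, *Cours d'arithmétique* II §3.3):

* `GaloisImage.not_exists_pow_eq_of_tateJ_eq_adicCompletion_of_unitCongruence_fails` — the `ℚ_v` form
  (`v` the place of `ℚ` over `p`), transported along Mathlib's continuous `ℚ`-algebra isomorphism
  `adicCompletion.padicEquiv v : ℚ_v ≃A[ℚ] ℚ_[p]`; the glue (`‖ι q‖ < 1` by `padicEquiv_bijOn`,
  `j(ι q) = ι j(q)` by `map_tateJ`) is VERBATIM that of the positive twin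
  `exists_pow_prime_eq_of_tateJ_eq_adicCompletion_rat` (`TateParameterPthPowerOfJProofs.lean`, abc-iut cell);
* `GaloisImage.unitCongruence_fails_of_intCertificate` — `p ∤ a`, `p ∤ b`, `p² ∤ a^{p−1} − b^{p−1}` ⟹ for
  `u = a/b`: `u ≠ 0`, `v_p(u) = 0`, `|u^{p−1} − 1|_p > p^{−2}` (the bookkeeping of ty2 g4's
  `natCard_localPTorsion_eq_one_of_split_of_intCertificate`, isolated);
* `GaloisImage.surj_of_mult_of_irr_of_unitCongruence_fails` / `…_of_tateIntCertificate` — **`Mult ∧ Irr ∧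
  (j(E)⁻¹ = p^k·u, u^{p−1} ≢ 1 mod p²) ⟹ Surj`** (`p` odd): at the place `v ∣ p` the Tate parameter exists
  (`|j|_v > 1`, ATAEC Lemma V.5.1 `existsUnique_tateJ_eq_of_one_lt_norm`) and is not a `p`-th power; then
  part 9 §1. NO place `v`, NO `q` in the statement;
* **`ClassX11a.surj_of_tateIntCertificate hX hju ha hb hunit : Surj W p`** (+ `ClassX11b` twin) — a per-pair
  KERNEL discharge of the displayed image bit `hsurj` at a peu-ramifié pair whose unit congruence fails:
  `hju : W.j⁻¹ = (p:ℚ)^k * ((a:ℚ)/(b:ℚ))` by `norm_num [WeierstrassCurve.j, c₄, Δ, b₂, b₄, b₆, b₈]` on the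
  literal model, `ha hb hunit` by `decide`. Example (checked in the seat's scratch, not shipped):
  `320045bh1 @ 5`, `W = [0,1,1,−600169720,−5659454700619]`, `(k, a, b) = (5, −1, 906618735030272)` — the
  same three `decide`s as the Tate-road certificate `natCard_localPTorsion_eq_one_of_split_of_intCertificate`
  (p563267); très-ramifié pairs keep x11c's `ClassX11a.surj_of_not_dvd`, the remaining peu-ramifié surjective
  pairs (`u^{p−1} ≡ 1 (p²)`) keep x11c's Frobenius witnesses
  `GaloisImage.hasSurjectiveModNGaloisRep_of_intModel_of_irr_of_order`.

HONEST FRAMING: per-pair tool (E1 currency when used by a record); NOT a class theorem; PARTITION currency 0;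
beyond-print theorem: no. References: [SilvermanATAEC1994] Thm. V.3.1 (b), Lemma V.5.1, Prop. V.6.1 and its
proof (PDF pp. 395, 406, 410–411); [Serre1973] Ch. II §3.3; [SerreInventiones1972] §2.4 Prop. 15 (p. 280);
cell files `X11a/PrintDischargeLocallySplit.lean` (part 9), `X11a/PrintDischargeKimDeepTate.lean` §3 (the
same certificate grammar), HOME/TY2-DISCHARGE-INTERFACE.md §N.
-/

set_option autoImplicit false

noncomputable section

open scoped Classical NumberField
open IsDedekindDomain Field NumberField
open WeierstrassCurve Literature.NumberTheory.EllipticCurves Literature.NumberTheory.GaloisRepresentations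
  Literature.NumberTheory.EllipticCurves.Rank1Residual Literature.NumberTheory.EllipticCurves.TateCurve
  Rat.HeightOneSpectrum

/-! ### §1 The negative `j`-criterion in `ℚ_v` and the surjectivity doors -/

namespace Summit.BirchSwinnertonDyer.Rank1Residual.GaloisImage

variable (W : WeierstrassCurve ℚ) [W.IsElliptic] (p : ℕ) [hp : Fact p.Prime]

omit hp in
/-- **The negative `j`-criterion in `ℚ_v`** (unit-congruence branch; `ℚ_v` the completion of `ℚ` at the
place `v` with `p_v = p` odd): for `j₀ ∈ ℚ` with `j₀⁻¹ = p^k·u`, `u ≠ 0`, `v_p(u) = 0` and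
`|u^{p−1} − 1|_p > p^{−2}`, NO `q ∈ ℚ_v` with `q ≠ 0`, `‖q‖ < 1`, `j(q) = j₀` (as `Rat.cast`; every ring map
`ℚ → ℚ_v` is `Rat.cast`, `eq_ratCast`) is a `p`-th power in `ℚ_v`.
Transport of ty2 g4's `not_exists_pow_prime_eq_of_tateJ_eq_ratCast` (in `ℚ_[p]`) along Mathlib's continuous
`ℚ`-algebra isomorphism `adicCompletion.padicEquiv v : ℚ_v ≃A[ℚ] ℚ_[p]` — the glue is VERBATIM that of
the positive twin `exists_pow_prime_eq_of_tateJ_eq_adicCompletion_rat` (`‖ι q‖ < 1` by `padicEquiv_bijOn`,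
`j(ι q) = ι j(q)` by `map_tateJ`). [cite: SilvermanATAEC1994, Thm. V.3.1 (b) and Lemma V.5.1 (PDF pp. 395, 406)]
[cite: Serre1973, Ch. II §3.3] -/
theorem not_exists_pow_eq_of_tateJ_eq_adicCompletion_of_unitCongruence_fails
    {v : HeightOneSpectrum (𝓞 ℚ)} (hv : (primesEquiv v : ℕ) = p) (hp2 : p ≠ 2)
    {j₀ u : ℚ} {k : ℕ} (hju : j₀⁻¹ = (p : ℚ) ^ k * u) (hu0 : u ≠ 0) (hu : padicValRat p u = 0)
    (hunit : (p : ℚ) ^ (-2 : ℤ) < padicNorm p (u ^ (p - 1) - 1))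
    {q : v.adicCompletion ℚ} (hq0 : q ≠ 0) (hq : ‖q‖ < 1)
    (hqj : tateJ q = ((j₀ : ℚ) : v.adicCompletion ℚ)) :
    ∀ y : v.adicCompletion ℚ, y ^ p ≠ q := by
  subst hv
  set P : Nat.Primes := primesEquiv v with hP
  haveI : Fact (P : ℕ).Prime := ⟨P.2⟩
  set ι := adicCompletion.padicEquiv (R := 𝓞 ℚ) v with hι
  -- `‖ι q‖ < 1`
  have hint : ∀ x : v.adicCompletion ℚ, ‖x‖ ≤ 1 → ‖ι x‖ ≤ 1 := fun x hx => by
    have hx' : x ∈ (v.adicCompletionIntegers ℚ : Set (v.adicCompletion ℚ)) := by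
      rw [SetLike.mem_coe, HeightOneSpectrum.mem_adicCompletionIntegers]
      exact Valued.toNormedField.norm_le_one_iff.mp hx
    exact (PadicInt.mem_subring_iff (P : ℕ)).mp
      ((adicCompletion.padicEquiv_bijOn (R := 𝓞 ℚ) v).mapsTo hx')
  have hq' : ‖ι q‖ < 1 := by
    rcases (hint q hq.le).lt_or_eq with h | h
    · exact h
    · exfalso
      have hinv : ‖(ι q)⁻¹‖ ≤ 1 := by rw [norm_inv, h, inv_one]
      have hmem : (ι q)⁻¹ ∈ (PadicInt.subring (P : ℕ) : Set ℚ_[P]) :=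
        (PadicInt.mem_subring_iff (P : ℕ)).mpr hinv
      obtain ⟨z, hz, hzq⟩ := (adicCompletion.padicEquiv_bijOn (R := 𝓞 ℚ) v).surjOn hmem
      rw [← hι] at hzq
      have hzq' : z = q⁻¹ := by
        have h1 := congrArg ι.symm hzq
        rw [← map_inv₀, ContinuousAlgEquiv.symm_apply_apply,
          ContinuousAlgEquiv.symm_apply_apply] at h1
        exact h1
      rw [SetLike.mem_coe, HeightOneSpectrum.mem_adicCompletionIntegers, hzq'] at hz
      have h1 : ‖q⁻¹‖ ≤ 1 := Valued.toNormedField.norm_le_one_iff.mpr hz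
      rw [norm_inv, inv_le_one₀ (norm_pos_iff.mpr hq0)] at h1
      exact absurd hq (not_lt.mpr h1)
  -- `j(ι q) = j₀`
  have hqj' : tateJ (ι q) = ((j₀ : ℚ) : ℚ_[P]) := by
    have h := map_tateJ (ι : v.adicCompletion ℚ →+* ℚ_[P]) ι.continuous hq
    rw [hqj] at h
    have hc : (ι : v.adicCompletion ℚ →+* ℚ_[P]) ((j₀ : ℚ) : v.adicCompletion ℚ) = ((j₀ : ℚ) : ℚ_[P]) :=
      map_ratCast _ j₀
    exact h.symm.trans hc
  intro y hy
  exact not_exists_pow_prime_eq_of_tateJ_eq_ratCast (p := (P : ℕ)) hp2 hq' hju hu0 hu hunit hqj'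
    ⟨ι y, by rw [← map_pow, hy]⟩

omit hp in
/-- The unit-congruence data of an INTEGER certificate: `p ∤ a`, `p ∤ b`, `p² ∤ a^{p−1} − b^{p−1}` ⟹ for
`u = a/b`: `u ≠ 0`, `v_p(u) = 0`, `|u^{p−1} − 1|_p = |a^{p−1} − b^{p−1}|_p ≥ p^{−1} > p^{−2}` (the three-line
bookkeeping of ty2 g4's `natCard_localPTorsion_eq_one_of_split_of_intCertificate`, isolated). [folklore] -/
theorem unitCongruence_fails_of_intCertificate (hp' : p.Prime) {a b : ℤ} (ha : ¬ (p : ℤ) ∣ a)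
    (hb : ¬ (p : ℤ) ∣ b) (hunit : ¬ (p : ℤ) ^ 2 ∣ a ^ (p - 1) - b ^ (p - 1)) :
    (a : ℚ) / (b : ℚ) ≠ 0 ∧ padicValRat p ((a : ℚ) / (b : ℚ)) = 0 ∧
      (p : ℚ) ^ (-2 : ℤ) < padicNorm p (((a : ℚ) / (b : ℚ)) ^ (p - 1) - 1) := by
  haveI : Fact p.Prime := ⟨hp'⟩
  have hP : Prime (p : ℤ) := Nat.prime_iff_prime_int.mp hp'
  have ha0 : a ≠ 0 := fun h ↦ ha (h ▸ dvd_zero _)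
  have hb0 : b ≠ 0 := fun h ↦ hb (h ▸ dvd_zero _)
  have haQ : (a : ℚ) ≠ 0 := Int.cast_ne_zero.mpr ha0
  have hbQ : (b : ℚ) ≠ 0 := Int.cast_ne_zero.mpr hb0
  have hu0 : (a : ℚ) / (b : ℚ) ≠ 0 := div_ne_zero haQ hbQ
  have hu : padicValRat p ((a : ℚ) / (b : ℚ)) = 0 := by
    rw [padicValRat.div haQ hbQ, padicValRat.of_int, padicValRat.of_int,
      padicValInt.eq_zero_of_not_dvd ha, padicValInt.eq_zero_of_not_dvd hb]
    simp
  refine ⟨hu0, hu, ?_⟩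
  set m : ℤ := a ^ (p - 1) - b ^ (p - 1) with hm
  have hm0 : m ≠ 0 := fun h ↦ hunit (by rw [h]; exact dvd_zero _)
  have hbpow : ¬ (p : ℤ) ∣ b ^ (p - 1) := fun h ↦ hb (hP.dvd_of_dvd_pow h)
  have hval : padicValInt p m ≤ 1 := by
    by_contra hlt
    exact hunit ((padicValInt_dvd_iff 2 m).mpr (Or.inr (by omega)))
  have heq : ((a : ℚ) / (b : ℚ)) ^ (p - 1) - 1 = (m : ℚ) / ((b ^ (p - 1) : ℤ) : ℚ) := by
    rw [hm, div_pow]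
    push_cast
    rw [div_sub_one (pow_ne_zero _ hbQ)]
  rw [heq, padicNorm.div, (padicNorm.int_eq_one_iff _).mpr hbpow, div_one,
    padicNorm.eq_zpow_of_nonzero (Int.cast_ne_zero.mpr hm0), padicValRat.of_int]
  exact zpow_lt_zpow_right₀ (by exact_mod_cast hp'.one_lt) (by omega)

/-- **`Mult ∧ Irr ∧ (j(E)⁻¹ = p^k·u, u^{p−1} ≢ 1 mod p²) ⟹ Surj` (`p` odd)** — §1 with its local datum
`q_E ∉ (ℚ_p^×)^p` discharged from the RATIONAL unit-congruence certificate: at the place `v ∣ p` the Tate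
parameter `q` of `E` exists (`|j|_v > 1`, ATAEC Lemma V.5.1 `existsUnique_tateJ_eq_of_one_lt_norm`) and is not
a `p`-th power (`not_exists_pow_eq_of_tateJ_eq_adicCompletion_of_unitCongruence_fails`). No place `v`, no `q` in
the statement. [cite: SilvermanATAEC1994, Prop. V.6.1 and its proof (PDF pp. 410–411), Thm. V.3.1 (b), Lemma V.5.1]
[cite: SerreInventiones1972, §2.4 Prop. 15 (p. 280)] [cite: Serre1973, Ch. II §3.3] -/
theorem surj_of_mult_of_irr_of_unitCongruence_fails (hp2 : p ≠ 2) (hmult : Mult W p) (hirr : Irr W p)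
    {u : ℚ} {k : ℕ} (hju : W.j⁻¹ = (p : ℚ) ^ k * u) (hu0 : u ≠ 0) (hu : padicValRat p u = 0)
    (hunit : (p : ℚ) ^ (-2 : ℤ) < padicNorm p (u ^ (p - 1) - 1)) : Surj W p := by
  obtain ⟨v, hv⟩ : ∃ v : HeightOneSpectrum (𝓞 ℚ), (primesEquiv v : ℕ) = p :=
    ⟨primesEquiv.symm ⟨p, hp.out⟩, by rw [Equiv.apply_symm_apply]⟩
  -- `j(W ⊗ ℚ_v) = j(W)` (stated before the local normed-field instance is installed)
  have hjv : (W.baseChange (v.adicCompletion ℚ)).j = _ := W.map_j _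
  letI := Literature.NumberTheory.GaloisRepresentations.Ultrametric.AdicCompletion.nontriviallyNormedField ℚ v
  haveI := charZero_adicCompletion' ℚ v
  have hmultv := hasMultiplicativeReductionAt_of_mult W p hv hmult
  have hj := one_lt_norm_j_baseChange_of_hasMultiplicativeReductionAt W v hmultv
  obtain ⟨q, ⟨hq0, hq, hqj⟩, -⟩ := existsUnique_tateJ_eq_of_one_lt_norm hj
  have hqj' : tateJ q = ((W.j : ℚ) : v.adicCompletion ℚ) := by
    rw [hqj, hjv]
    exact eq_ratCast _ _
  exact surj_of_mult_of_irr_of_forall_pow_ne_tateParameter W p hp2 hmult hirr hv hq0 hq hqj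
    (not_exists_pow_eq_of_tateJ_eq_adicCompletion_of_unitCongruence_fails p hv hp2 hju hu0 hu hunit
      hq0 hq hqj')

/-- **Integer-certificate form** (the shape a record DISPLAYS and `decide` checks): `Mult ∧ Irr`, `p` odd,
`j(E)⁻¹ = p^k·(a/b)` with `p ∤ a`, `p ∤ b`, `p² ∤ a^{p−1} − b^{p−1}` ⟹ `Surj`. E.g. `320045bh1 @ 5`:
`(k, a, b) = (5, −1, 906618735030272)` — the same three `decide`s as the Tate-road certificate
`natCard_localPTorsion_eq_one_of_split_of_intCertificate` (p563267). [cite: SilvermanATAEC1994, Prop. V.6.1 (PDF pp. 410–411)]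
[cite: SerreInventiones1972, §2.4 Prop. 15 (p. 280)] [cite: Serre1973, Ch. II §3.3] -/
theorem surj_of_mult_of_irr_of_tateIntCertificate (hp2 : p ≠ 2) (hmult : Mult W p) (hirr : Irr W p)
    {a b : ℤ} {k : ℕ} (hju : W.j⁻¹ = (p : ℚ) ^ k * ((a : ℚ) / (b : ℚ))) (ha : ¬ (p : ℤ) ∣ a)
    (hb : ¬ (p : ℤ) ∣ b) (hunit : ¬ (p : ℤ) ^ 2 ∣ a ^ (p - 1) - b ^ (p - 1)) : Surj W p := by
  obtain ⟨hu0, hu, hunit'⟩ := unitCongruence_fails_of_intCertificate p hp.out ha hb hunit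
  exact surj_of_mult_of_irr_of_unitCongruence_fails W p hp2 hmult hirr hju hu0 hu hunit'

end Summit.BirchSwinnertonDyer.Rank1Residual.GaloisImage

/-! ### §2 On the classes X11a / X11b -/

namespace Summit.BirchSwinnertonDyer.Rank1Residual

open GaloisImage

variable (W : WeierstrassCurve ℚ) [W.IsElliptic] [W.IsGloballyMinimal] (p : ℕ) [hp : Fact p.Prime]

/-- **X11a: the image bit `Surj W p` from the RATIONAL Tate certificate** `j(E)⁻¹ = p^k·(a/b)`, `p ∤ a`,
`p ∤ b`, `p² ∤ a^{p−1} − b^{p−1}` (class supplies `p ≠ 2`, `Mult`, `Irr`) — a per-pair KERNEL discharge of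
the displayed `hsurj` at a peu-ramifié pair whose unit congruence fails (très-ramifié pairs: x11c's
`ClassX11a.surj_of_not_dvd`; the rest: x11c's Frobenius witnesses).
[cite: SilvermanATAEC1994, Prop. V.6.1 and its proof (PDF pp. 410–411)] [cite: SerreInventiones1972, §2.4 Prop. 15 (p. 280)] -/
theorem ClassX11a.surj_of_tateIntCertificate (hX : ClassX11a W p) {a b : ℤ} {k : ℕ}
    (hju : W.j⁻¹ = (p : ℚ) ^ k * ((a : ℚ) / (b : ℚ))) (ha : ¬ (p : ℤ) ∣ a) (hb : ¬ (p : ℤ) ∣ b)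
    (hunit : ¬ (p : ℤ) ^ 2 ∣ a ^ (p - 1) - b ^ (p - 1)) : Surj W p :=
  surj_of_mult_of_irr_of_tateIntCertificate W p hX.2.1 hX.2.2.1 hX.2.2.2.1 hju ha hb hunit

omit [W.IsGloballyMinimal] in
/-- **X11b twin** (rank `1` sister class). [cite: SilvermanATAEC1994, Prop. V.6.1 (PDF pp. 410–411)]
[cite: SerreInventiones1972, §2.4 Prop. 15 (p. 280)] -/
theorem ClassX11b.surj_of_tateIntCertificate (hX : ClassX11b W p) {a b : ℤ} {k : ℕ}
    (hju : W.j⁻¹ = (p : ℚ) ^ k * ((a : ℚ) / (b : ℚ))) (ha : ¬ (p : ℤ) ∣ a) (hb : ¬ (p : ℤ) ∣ b)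
    (hunit : ¬ (p : ℤ) ^ 2 ∣ a ^ (p - 1) - b ^ (p - 1)) : Surj W p :=
  surj_of_mult_of_irr_of_tateIntCertificate W p hX.2.1 hX.2.2.1 hX.2.2.2 hju ha hb hunit

end Summit.BirchSwinnertonDyer.Rank1Residual

end
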